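import Mathlib

/-!
# Census numerics helper: one Schur-complement (pivot) step for determinants on `Fin (n+1)`

HONEST FRAMING.  Object-search cell `pub-symmetroid`, seat val-sym-eng-3 g8 (census/instrument engine #3).  HELPER of
the crux item `stmt-ValiantsHypothesis-18050` with NO closure claim: a determinant-evaluation identity used by the
numeric sign certificates of the `K = 3` stamp column (`…FiniteSectorRealisableTenThree` and later cells), where the
FOLDED Laplace lemmas (`det_fin_nine_laplace_fold4`, `det_fin_ten_laplace_fold4`) are too large for `simp`/`norm_num`
at `m ≥ 10`.  Gaussian elimination instead: if the pivot `M 0 0` is non-zero then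
`det M = M 0 0 * det (Schur complement)`, the Schur complement being the explicit `n × n` matrix
`(i, j) ↦ M i.succ j.succ - M i.succ 0 * M 0 j.succ / M 0 0`.  Applied `m - 1` times (side goals `pivot ≠ 0` by
`norm_num`) it evaluates an explicit `m × m` determinant in `O(m³)` cached arithmetic steps instead of a Laplace/Leibniz
expansion.  [folklore] linear algebra (row operations + cofactor expansion along the first column); nothing here bears
on the crux or on `VP ≠ VNP`.
-/

-- `Summit.ValiantsHypothesis.ValiantsHypothesis.…` repeats a component by the D-0017 layout
-- (single-conjunct summit), which the `dupNamespace` linter flags; the name is mandated.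
set_option linter.dupNamespace false

namespace Summit.ValiantsHypothesis.ValiantsHypothesis.Theorems.LacunarySymmetroidMatrixDescartes.Census

open scoped BigOperators Matrix

/-- **Schur / pivot step.**  Over a field, if `M 0 0 ≠ 0` then
`det M = M 0 0 * det (of fun i j => M i.succ j.succ - M i.succ 0 * M 0 j.succ / M 0 0)`
(subtract `M i 0 / M 0 0` times row `0` from every other row, then expand along column `0`). [folklore] -/
theorem det_succ_schur {K : Type*} [Field K] {n : ℕ} (M : Matrix (Fin (n + 1)) (Fin (n + 1)) K)
    (h : M 0 0 ≠ 0) :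
    M.det = M 0 0 * (Matrix.of fun i j : Fin n => M i.succ j.succ - M i.succ 0 * M 0 j.succ / M 0 0).det := by
  -- the row-reduced matrix
  let N : Matrix (Fin (n + 1)) (Fin (n + 1)) K :=
    Matrix.of fun i j => if i = 0 then M 0 j else M i j - M i 0 * M 0 j / M 0 0
  have hMN : M.det = N.det := by
    refine Matrix.det_eq_of_forall_row_eq_smul_add_const (fun i => if i = 0 then 0 else M i 0 / M 0 0) 0
      (by simp) (fun i j => ?_)
    by_cases hi : i = 0
    · subst hi; simp [N]
    · simp only [N, Matrix.of_apply, hi, if_false, if_true]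
      field_simp
      ring
  rw [hMN, Matrix.det_succ_column_zero, Fin.sum_univ_succ]
  have hcol : ∀ i : Fin n, N i.succ 0 = 0 := by
    intro i
    simp only [N, Matrix.of_apply, Fin.succ_ne_zero, if_false]
    field_simp
    ring
  have hsub : N.submatrix (Fin.succAbove 0) Fin.succ =
      Matrix.of fun i j : Fin n => M i.succ j.succ - M i.succ 0 * M 0 j.succ / M 0 0 := by
    ext i j
    simp [N, Matrix.submatrix_apply, Fin.succ_ne_zero]
  simp only [hcol, zero_mul, mul_zero, Finset.sum_const_zero, add_zero, Fin.val_zero, pow_zero, one_mul]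
  rw [hsub]
  simp [N]

end Summit.ValiantsHypothesis.ValiantsHypothesis.Theorems.LacunarySymmetroidMatrixDescartes.Census
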